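import Summits.BirchSwinnertonDyer.BirchSwinnertonDyer.Theorems.UniversalToricDescentTwinMemberRationalInclusionAtThreeOfTwoVarCoreSelfDual
import Summits.BirchSwinnertonDyer.BirchSwinnertonDyer.Theorems.UniversalToricDescentDegreeOnlyTwinSqueeze
import HarnessLib

/-!
# Route `UniversalToricDescent`, B column: K1♯† (stmt-BirchSwinnertonDyer-23310 `TwinSelfDualMemberRationalInclusionAtThree`) versus the
# two-variable road TV₃† — the road delivers K1♯† ON THE TRÈS-RAMIFIÉ LOCUS (K1♯†_T), which is all that ♭B′ 27401 and ♭B′° 22539 consume;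
# the residue of «K1♯† ⟸ TV₃†» is exactly the peu-ramifié corner

Cell `bsd-wall`, width seat `bsd-wall-utd-b-w1` (prover g0, 2026-08-29; explicit-unit, RE-KEYED by the operator 00:09Z onto pen pss3x g7's
PART 2 item (4): «K1♯† 23310 ⟸ TV₃† kernel half, --supports 23310»); `--supports stmt-BirchSwinnertonDyer-23310` (helper). Theorems only
(no definition, no named fact, no `sorry`); standard axioms.

## What is asked, what the kernel can give, and what it cannot

TV₃† (the two-variable Σ-imprimitive core on the SELF-DUAL module `AnticyclotomicBigGaloisRep κ (D.Δ.selfDualCofreeRepOver K)`, weight clause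
`2(3−1)3^{m−1} ∣ k_m − 2`, pinned on `T_c = 0` to the member's Σ-frame; text = hypothesis `hTV` of p663826 §1† VERBATIM) carries — like the descent
it feeds ([JetchevSkinnerWan2017] Cor. 3.4.2; [Castella2018Erratum] Lemma 2.1 «`H⁰(K_𝔭̄, A_g[ϖ]) = 0`») — the binder (dec)† «`A†_{g_m}` has no non-zero
`Γ_{K_𝔭′}`-fixed `3`-power torsion». p663826 §1† `sharpDecDagger_of_twoVarCoreAtThreeDagger : TV₃† → K1♯ᵈ†` keeps that binder. Item 23310 (K1♯†) has
NO such binder and NO très-ramifié binder: it also speaks about members congruent to a twin `W′` SPLIT multiplicative at `3` whose Tate parameter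
is a cube (`W′(ℚ₃)[3] ≠ 0`, hence `A†_{g_m}[ϖ]^{Γ_{ℚ₃}} ≠ 0` by the congruence): there the two-variable descent is not available and no engine is in
print. So «K1♯† ⟸ TV₃†» BY NAME is NOT a kernel statement; what IS, and what this file lands:

* §1 `tresSelfDual_of_decSelfDual : K1♯ᵈ† → K1♯†_T`, where **K1♯†_T := item 23310's text with ONE extra binder
  `¬ 3 ∣ padicValInt 3 W'.minimalDiscriminantInt →` after `Odd (NumberField.discr K) →`** (the très-ramifié binder of ♭B′ 27401 / ♭B′° 22539,
  same place). Proof: (dec) for the twin (`twin_dec_of_forall_not_cube`), `K_𝔭′ → ℚ₃` at the degree-one `𝔭′`, `BigRep.hdec_geomPoints_of_padicTorsion`,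
  transported to `A†_{g_m}` by (b†) under the weight clause (`SelfDualTwist.forall_fixed_primary_eq_zero_selfDual`) — the (dec)† line of p663826 §2†,
  isolated. `tresSelfDual_of_selfDual : K1♯† → K1♯†_T` (monotonicity: a proof of 23310 as filed still serves).
* §2 `tresSelfDual_of_twoVarCoreAtThreeDagger : TV₃† → K1♯†_T` (§1 ∘ p663826 §1†) — THE KERNEL HALF OF THE TV₃† ROAD in the form the items can use.
* §3 `selfDual_of_tresSelfDual_of_peuRamifie : K1♯†_T → K1♯†_peu → K1♯†` (K1♯†_peu := 23310's text with the complementary binder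
  `3 ∣ padicValInt 3 W'.minimalDiscriminantInt →`): item 23310 = (what the road gives) ∧ (the peu-ramifié corner), `by_cases`.
* Companion file `UniversalToricDescentTwinFramesAtThreeOfTresSelfDual` (same seat): ♭B′° 22539 BY NAME from {`C_min†` / fact† 23284, K1♯†_T}
  WITHOUT Hsieh Thm B and from {fact†, TV₃†}; ♭B′ 27401 BY NAME from {Hsieh Thm B, supply, K1♯†_T} — the B column reads K1♯† ONLY on the
  très-ramifié locus, so a pen restatement 23310 ↦ K1♯†_T (one binder) keeps glue† 23330's shape and becomes closable from TV₃† by §2.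

READING (numbers, not adjectives). Research residue of the B column after this file: TV₃† (unchanged: no Eisenstein-side engine in print at `p = 3`)
— and, ONLY IF item 23310 is kept as filed, additionally its peu-ramifié corner (members over twins multiplicative at `3` with `3 ∣ v₃(Δ′_min)`,
containing the split-multiplicative cube-Tate-parameter twins), which no route consumer reads (♭B′/♭B′° carry the très-ramifié binder; S_A 27387
resupplies peu-ramifié twins). Items closed 0; classes closed 0; BSD is proved for no curve.

RESTATE-ROBUST (T1 of pen pss3x g7's sequence T1 → T2 → T3, 2026-08-29T01:06:02Z; width seat bsd-wall-utd-b-w1 g2): §1b and §3 — the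
only two proofs of this module that read item 23310 BY NAME — carry two-branch `first | … | …` proofs: branch 1 elaborates while
`TwinSelfDualMemberRationalInclusionAtThree` is K1♯† as filed (rev 73–78), branch 2 once the pen restates it to K1♯†_T (T2; then §1b is
the identity and §3 ignores `hpeu`). Statements unchanged; exactly one branch elaborates at any route rev (dormant branch checked against a
local copy of the K1♯†_T text, work/RestateSimT1.lean of that seat).

References: [Castella2018Erratum] §2 (p. 2), Lemma 2.1, (2.4)–(2.5), proof of Thm. 1.1 (a)(b)(c); [JetchevSkinnerWan2017] §3.4, Lemma 3.4.1, Cor. 3.4.2;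
[Skinner2016PacificMC] §2.6, §3.1 (a)(b); [Hsieh2014] Thm. B; [Castella2020JIMJ] Thm. 2.11; [GreenbergVatsal2000] Thm. (1.4).
-/

noncomputable section

open scoped Classical

set_option linter.dupNamespace false
set_option autoImplicit false

namespace Summit.BirchSwinnertonDyer.BirchSwinnertonDyer.Theorems.UniversalToricDescentTwinSelfDualMemberRationalInclusionAtThreeTres

open PowerSeries WeierstrassCurve NumberField IsDedekindDomain Field
  Literature.NumberTheory.EllipticCurves
  Literature.NumberTheory.EllipticCurves.ModularForms
  Literature.NumberTheory.EllipticCurves.Rank1Residual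
  Literature.NumberTheory.EllipticCurves.BigGaloisRep
  Literature.NumberTheory.EllipticCurves.GreenbergSelmer
  Literature.NumberTheory.GaloisRepresentations
  Summit.BirchSwinnertonDyer.Rank1Residual.X11b
  Summit.BirchSwinnertonDyer.Rank1Residual.X11b.Halves
  Summit.BirchSwinnertonDyer.BirchSwinnertonDyer.Theorems.SchneiderFree
  Summit.BirchSwinnertonDyer.BirchSwinnertonDyer.Theorems.UniversalToricDescentTwinTorsionRankOne
  Summit.BirchSwinnertonDyer.BirchSwinnertonDyer.Theorems.UniversalToricDescentTwinDecLocus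
  Summit.BirchSwinnertonDyer.BirchSwinnertonDyer.Theorems.UniversalToricDescentTwinWanFrameAtThreeMultTresTAllSplitSelfDual
  Summit.BirchSwinnertonDyer.BirchSwinnertonDyer.Theorems.UniversalToricDescentTwinMemberRationalInclusionAtThreeOfTwoVarCoreSelfDual
  Summit.BirchSwinnertonDyer.BirchSwinnertonDyer.Theorems.UniversalToricDescentKernelDegreeOnlyTwin
  Summit.BirchSwinnertonDyer.BirchSwinnertonDyer.Theses.UniversalToricDescent
  Summit.BirchSwinnertonDyer.BirchSwinnertonDyer.Theorems

/-! ### §1 K1♯ᵈ† ⟹ K1♯†_T: on the très-ramifié locus the (dec)† binder discharges itself -/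

set_option maxHeartbeats 800000 in
-- statement-sized binders over the big representation (as p662412 / p663826); the proof is glue
/-- **K1♯ᵈ† ⟹ K1♯†_T.** K1♯ᵈ† = item 23310's text with the binder (dec)† on `D.Δ.selfDualCofreeRepOver K` (hypothesis `hK1` of p663826 §2†
VERBATIM); K1♯†_T = item 23310's text with the très-ramifié binder `¬ 3 ∣ v₃(Δ′_min)` of ♭B′ inserted after `Odd (NumberField.discr K) →`. On a
très-ramifié twin, `W′(ℚ₃)[3] = 0` (`twin_dec_of_forall_not_cube`), `K_𝔭′ ≃ ℚ₃` at the degree-one `𝔭′`, hence no `Γ_{K_𝔭′}`-fixed geometric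
`3`-torsion (`BigRep.hdec_geomPoints_of_padicTorsion`), transported to `A†_{g_m}` through (b†) under the weight clause
(`SelfDualTwist.forall_fixed_primary_eq_zero_selfDual`). [cite: Castella2018Erratum, §2 (p. 2), Lemma 2.1 (pp. 1–2), proof of Thm. 1.1 (a)(b)]
[cite: Skinner2016PacificMC, §2.6 (2-6-1), §3.1 (b)] -/
theorem tresSelfDual_of_decSelfDual
    (hK1d :
    ∀ (W' : WeierstrassCurve ℚ) [W'.IsElliptic] [W'.IsGloballyMinimal] (N' : ℕ) [NeZero N']
      (K : Type) [Field K] [NumberField K] (Dt' : ModularParametrizationData W' N'),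
      Mult W' 3 → W'.HasSurjectiveModNGaloisRep 3 → W'.conductorNorm ℤ = N' → IsImaginaryQuadratic K →
      SatisfiesHeegnerHypothesis N' K → Odd (NumberField.discr K) →
      ∀ (κ : ZpExtension K 3), κ.IsAnticyclotomic → ∀ (γ : absoluteGaloisGroup K) [Fact (κ.IsTopGenerator γ)]
        (𝔭 : HeightOneSpectrum (𝓞 K)), ((3 : ℕ) : 𝓞 K) ∈ 𝔭.asIdeal →
        𝔭.asIdeal.ramificationIdx (𝓞 ℚ) = 1 → 𝔭.asIdeal.inertiaDeg (𝓞 ℚ) = 1 →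
        ∀ (𝔭' : HeightOneSpectrum (𝓞 K)), ((3 : ℕ) : 𝓞 K) ∈ 𝔭'.asIdeal → 𝔭' ≠ 𝔭 →
        ∀ (ι' : PadicAlgCl 3 ≃+* ℂ), BranchInducesPrime 3 ι' 𝔭 →
        ∀ (m : ℕ), 1 ≤ m → ∀ (D : Skinner2016.HidaCongruentMember W' 3 m),
          (2 * (((3 : ℕ) : ℤ) - 1) * ((3 : ℕ) : ℤ) ^ (m - 1)) ∣ D.k - 2 →
          SkinnerUrban2014.IsResiduallyIrreducible D.Δ →
          (∀ a : Cofree D.Δ.selfDualRep (padicCoeffField D.ι),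
              (∀ σ : LocalGroup K (Sum.inl 𝔭'), (D.Δ.selfDualCofreeRepOver K) (localMap K (Sum.inl 𝔭') σ) a = a) →
              (∃ j : ℕ, (3 : ℕ) ^ j • a = 0) → a = 0) →
          (∀ x : coeffField D.g, ι' (D.ι x) = (x : ℂ)) →
        ∀ (b : padicCoeffIntegers D.ι →+* 𝓞_ℂ_[3]),
          (∀ x, ((b x : 𝓞_ℂ_[3]) : ℂ_[3]) = algebraMap (PadicAlgCl 3) ℂ_[3] (padicCoeffIntegers.toPadicAlgCl D.ι x)) →
        ∀ (ΩK : ℂ) (Ωp : (𝓞_ℂ_[3])ˣ) (Q : PowerSeries 𝓞_ℂ_[3]), ΩK ≠ 0 →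
          IsBDPLFunctionWtSigmaInt ι' 𝔭 κ γ D.g (W'.sigmaPlacesFinset 3 K) ΩK ((Ωp : 𝓞_ℂ_[3]) : ℂ_[3]) Q →
        ∀ [TopologicalSpace (PowerSeries (padicCoeffIntegers D.ι))]
          [ContinuousSMul (PowerSeries (padicCoeffIntegers D.ι))
            (BigRepModule (padicCoeffIntegers D.ι) 3 (Cofree D.Δ.selfDualRep (padicCoeffField D.ι)))],
          Module.IsTorsion (PowerSeries (padicCoeffIntegers D.ι))
              (XBig κ (D.Δ.selfDualCofreeRepOver K) 𝔭' (↑(W'.sigmaPlacesFinset 3 K))) →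
            ∃ e : ℕ, Ideal.span {(PowerSeries.C ((3 : ℕ) : 𝓞_ℂ_[3]) : PowerSeries 𝓞_ℂ_[3]) ^ e} *
                (XBig.charIdeal κ (D.Δ.selfDualCofreeRepOver K) 𝔭' (↑(W'.sigmaPlacesFinset 3 K))).map (PowerSeries.map b) ≤
              Ideal.span {Q}) :
    ∀ (W' : WeierstrassCurve ℚ) [W'.IsElliptic] [W'.IsGloballyMinimal] (N' : ℕ) [NeZero N']
      (K : Type) [Field K] [NumberField K] (Dt' : ModularParametrizationData W' N'),
      Mult W' 3 → W'.HasSurjectiveModNGaloisRep 3 → W'.conductorNorm ℤ = N' → IsImaginaryQuadratic K →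
      SatisfiesHeegnerHypothesis N' K → Odd (NumberField.discr K) → ¬ 3 ∣ padicValInt 3 W'.minimalDiscriminantInt →
      ∀ (κ : ZpExtension K 3), κ.IsAnticyclotomic → ∀ (γ : absoluteGaloisGroup K) [Fact (κ.IsTopGenerator γ)]
        (𝔭 : HeightOneSpectrum (𝓞 K)), ((3 : ℕ) : 𝓞 K) ∈ 𝔭.asIdeal →
        𝔭.asIdeal.ramificationIdx (𝓞 ℚ) = 1 → 𝔭.asIdeal.inertiaDeg (𝓞 ℚ) = 1 →
        ∀ (𝔭' : HeightOneSpectrum (𝓞 K)), ((3 : ℕ) : 𝓞 K) ∈ 𝔭'.asIdeal → 𝔭' ≠ 𝔭 →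
        ∀ (ι' : PadicAlgCl 3 ≃+* ℂ), BranchInducesPrime 3 ι' 𝔭 →
        ∀ (m : ℕ), 1 ≤ m → ∀ (D : Skinner2016.HidaCongruentMember W' 3 m),
          (2 * (((3 : ℕ) : ℤ) - 1) * ((3 : ℕ) : ℤ) ^ (m - 1)) ∣ D.k - 2 →
          SkinnerUrban2014.IsResiduallyIrreducible D.Δ →
          (∀ x : coeffField D.g, ι' (D.ι x) = (x : ℂ)) →
        ∀ (b : padicCoeffIntegers D.ι →+* 𝓞_ℂ_[3]),
          (∀ x, ((b x : 𝓞_ℂ_[3]) : ℂ_[3]) = algebraMap (PadicAlgCl 3) ℂ_[3] (padicCoeffIntegers.toPadicAlgCl D.ι x)) →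
        ∀ (ΩK : ℂ) (Ωp : (𝓞_ℂ_[3])ˣ) (Q : PowerSeries 𝓞_ℂ_[3]), ΩK ≠ 0 →
          IsBDPLFunctionWtSigmaInt ι' 𝔭 κ γ D.g (W'.sigmaPlacesFinset 3 K) ΩK ((Ωp : 𝓞_ℂ_[3]) : ℂ_[3]) Q →
        ∀ [TopologicalSpace (PowerSeries (padicCoeffIntegers D.ι))]
          [ContinuousSMul (PowerSeries (padicCoeffIntegers D.ι))
            (BigRepModule (padicCoeffIntegers D.ι) 3 (Cofree D.Δ.selfDualRep (padicCoeffField D.ι)))],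
          Module.IsTorsion (PowerSeries (padicCoeffIntegers D.ι))
              (XBig κ (D.Δ.selfDualCofreeRepOver K) 𝔭' (↑(W'.sigmaPlacesFinset 3 K))) →
            ∃ e : ℕ, Ideal.span {(PowerSeries.C ((3 : ℕ) : 𝓞_ℂ_[3]) : PowerSeries 𝓞_ℂ_[3]) ^ e} *
                (XBig.charIdeal κ (D.Δ.selfDualCofreeRepOver K) 𝔭' (↑(W'.sigmaPlacesFinset 3 K))).map (PowerSeries.map b) ≤
              Ideal.span {Q} := by
  intro W' _ _ N' _ K _ _ Dt' hmult hsurj hN' hK hH hodd hndvd κ hκ γ _ 𝔭 h𝔭 he hf 𝔭' h𝔭' hne ι' hι' m hm D hk hirr hι b hb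
    ΩK Ωp Q hΩK hQ _i1 _i2 hT
  -- (dec) for the twin from the très-ramifié binder
  have hdec : ∀ Q : (W'.baseChange ℚ_[3]).toAffine.Point, 3 • Q = 0 → Q = 0 :=
    twin_dec_of_forall_not_cube W' hmult (forall_not_exists_pow_of_nonsplit_or_not_dvd W' (Or.inr hndvd))
  have hsplit : ((Ideal.span {((3 : ℕ) : ℤ)}).primesOver (𝓞 K)).ncard = 2 :=
    ncard_primesOver_eq_two_of_degreeOne hK.1 h𝔭 he hf
  -- `K_𝔭′ → ℚ₃` at the degree-one prime `𝔭′`; no `Γ_{K_𝔭′}`-fixed geometric `3`-torsion; transport through (b†)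
  have hN0 : W'.conductorNorm ℤ ≠ 0 := (W'.conductorNorm_pos_holds).ne'
  haveI : NeZero (W'.conductorNorm ℤ / 3) :=
    ⟨(Nat.div_pos (Nat.le_of_dvd (Nat.pos_of_ne_zero hN0) (dvd_conductorNorm_of_mult hmult)) (by norm_num)).ne'⟩
  obtain ⟨heb, hfb⟩ := degreeOne_of_splitsIn hK.1 hsplit h𝔭'
  obtain ⟨φ⟩ := AcSelmer.exists_ringHom_adicCompletion_padic_of_degreeOne 3 𝔭' h𝔭' heb hfb
  have h0 := BigRep.hdec_geomPoints_of_padicTorsion W' 3 K 𝔭' φ hdec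
  haveI := D.moduleFree_coeffRing
  have hdecD : ∀ a : Cofree D.Δ.selfDualRep (padicCoeffField D.ι),
      (∀ σ : LocalGroup K (Sum.inl 𝔭'), (D.Δ.selfDualCofreeRepOver K) (localMap K (Sum.inl 𝔭') σ) a = a) →
      (∃ j : ℕ, (3 : ℕ) ^ j • a = 0) → a = 0 :=
    SelfDualTwist.forall_fixed_primary_eq_zero_selfDual D K hm hk
      (fun σ : absoluteGaloisGroup (𝔭'.adicCompletion K) => absGaloisRestrict K (𝔭'.adicCompletion K) σ) h0
  exact hK1d W' N' K Dt' hmult hsurj hN' hK hH hodd κ hκ γ 𝔭 h𝔭 he hf 𝔭' h𝔭' hne ι' hι' m hm D hk hirr hdecD hι b hb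
    ΩK Ωp Q hΩK hQ hT

-- the dormant branch of a restate-robust `first | … | …` is, by design, never executed at the current route rev
set_option linter.unreachableTactic false in
set_option linter.unusedTactic false in
/-- **K1♯† (item 23310 as filed) ⟹ K1♯†_T** — monotonicity: any proof of `TwinSelfDualMemberRationalInclusionAtThree` still serves the
très-ramifié reading (the extra binder is simply not used). [folklore] -/
theorem tresSelfDual_of_selfDual (hK1 : TwinSelfDualMemberRationalInclusionAtThree) :
    ∀ (W' : WeierstrassCurve ℚ) [W'.IsElliptic] [W'.IsGloballyMinimal] (N' : ℕ) [NeZero N']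
      (K : Type) [Field K] [NumberField K] (Dt' : ModularParametrizationData W' N'),
      Mult W' 3 → W'.HasSurjectiveModNGaloisRep 3 → W'.conductorNorm ℤ = N' → IsImaginaryQuadratic K →
      SatisfiesHeegnerHypothesis N' K → Odd (NumberField.discr K) → ¬ 3 ∣ padicValInt 3 W'.minimalDiscriminantInt →
      ∀ (κ : ZpExtension K 3), κ.IsAnticyclotomic → ∀ (γ : absoluteGaloisGroup K) [Fact (κ.IsTopGenerator γ)]
        (𝔭 : HeightOneSpectrum (𝓞 K)), ((3 : ℕ) : 𝓞 K) ∈ 𝔭.asIdeal →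
        𝔭.asIdeal.ramificationIdx (𝓞 ℚ) = 1 → 𝔭.asIdeal.inertiaDeg (𝓞 ℚ) = 1 →
        ∀ (𝔭' : HeightOneSpectrum (𝓞 K)), ((3 : ℕ) : 𝓞 K) ∈ 𝔭'.asIdeal → 𝔭' ≠ 𝔭 →
        ∀ (ι' : PadicAlgCl 3 ≃+* ℂ), BranchInducesPrime 3 ι' 𝔭 →
        ∀ (m : ℕ), 1 ≤ m → ∀ (D : Skinner2016.HidaCongruentMember W' 3 m),
          (2 * (((3 : ℕ) : ℤ) - 1) * ((3 : ℕ) : ℤ) ^ (m - 1)) ∣ D.k - 2 →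
          SkinnerUrban2014.IsResiduallyIrreducible D.Δ →
          (∀ x : coeffField D.g, ι' (D.ι x) = (x : ℂ)) →
        ∀ (b : padicCoeffIntegers D.ι →+* 𝓞_ℂ_[3]),
          (∀ x, ((b x : 𝓞_ℂ_[3]) : ℂ_[3]) = algebraMap (PadicAlgCl 3) ℂ_[3] (padicCoeffIntegers.toPadicAlgCl D.ι x)) →
        ∀ (ΩK : ℂ) (Ωp : (𝓞_ℂ_[3])ˣ) (Q : PowerSeries 𝓞_ℂ_[3]), ΩK ≠ 0 →
          IsBDPLFunctionWtSigmaInt ι' 𝔭 κ γ D.g (W'.sigmaPlacesFinset 3 K) ΩK ((Ωp : 𝓞_ℂ_[3]) : ℂ_[3]) Q →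
        ∀ [TopologicalSpace (PowerSeries (padicCoeffIntegers D.ι))]
          [ContinuousSMul (PowerSeries (padicCoeffIntegers D.ι))
            (BigRepModule (padicCoeffIntegers D.ι) 3 (Cofree D.Δ.selfDualRep (padicCoeffField D.ι)))],
          Module.IsTorsion (PowerSeries (padicCoeffIntegers D.ι))
              (XBig κ (D.Δ.selfDualCofreeRepOver K) 𝔭' (↑(W'.sigmaPlacesFinset 3 K))) →
            ∃ e : ℕ, Ideal.span {(PowerSeries.C ((3 : ℕ) : 𝓞_ℂ_[3]) : PowerSeries 𝓞_ℂ_[3]) ^ e} *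
                (XBig.charIdeal κ (D.Δ.selfDualCofreeRepOver K) 𝔭' (↑(W'.sigmaPlacesFinset 3 K))).map (PowerSeries.map b) ≤
              Ideal.span {Q} := by
  -- RESTATE-ROBUST (pen pss3x g7 sequence T1, 2026-08-29T01:06:02Z): branch 1 reads `hK1` = item 23310 as filed (K1♯†: no
  -- très-ramifié binder, the extra hypothesis is dropped); branch 2 reads `hK1` = item 23310 restated to K1♯†_T (T2: the
  -- conclusion is then the item verbatim). Exactly one branch elaborates at any route rev.
  first
  | exact fun W' _ _ N' _ K _ _ Dt' hmult hsurj hN' hK hH hodd _ κ hκ γ _ 𝔭 h𝔭 he hf 𝔭' h𝔭' hne ι' hι' ↦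
      hK1 W' N' K Dt' hmult hsurj hN' hK hH hodd κ hκ γ 𝔭 h𝔭 he hf 𝔭' h𝔭' hne ι' hι'
  | exact hK1

/-! ### §2 The kernel half of the TV₃† road, in item-usable form: TV₃† ⟹ K1♯†_T -/

set_option maxHeartbeats 800000 in
-- statement-sized binders over the big representation (as p662412 / p663826); the proof is glue
/-- **TV₃† ⟹ K1♯†_T**: the two-variable Σ-imprimitive core on the self-dual module (hypothesis `hTV` of p663826 §1† VERBATIM) gives item
23310's statement ON THE TRÈS-RAMIFIÉ LOCUS — §1 ∘ `sharpDecDagger_of_twoVarCoreAtThreeDagger` (exact two-variable control, cyclotomic `κ′`,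
determinant trick, descent of `Ch` along `T_c ↦ 0`, `e = 0`; then (dec)† discharged by §1). This is the closer of a restated item
23310 ↦ K1♯†_T from a research stub := TV₃†. [cite: JetchevSkinnerWan2017, §3.4, Lemma 3.4.1 and Cor. 3.4.2 (arXiv:1512.06894 p. 14)]
[cite: Castella2018Erratum, §2 (p. 2), Lemma 2.1, (2.4) ⇒ (2.5) (p. 4)] -/
theorem tresSelfDual_of_twoVarCoreAtThreeDagger
    (hTV :
    ∀ (W' : WeierstrassCurve ℚ) [W'.IsElliptic] [W'.IsGloballyMinimal] (N' : ℕ) [NeZero N']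
      (K : Type) [Field K] [NumberField K] (Dt' : ModularParametrizationData W' N'),
      Mult W' 3 → W'.HasSurjectiveModNGaloisRep 3 → W'.conductorNorm ℤ = N' → IsImaginaryQuadratic K →
      SatisfiesHeegnerHypothesis N' K → Odd (NumberField.discr K) →
      ∀ (κ : ZpExtension K 3), κ.IsAnticyclotomic → ∀ (γ : absoluteGaloisGroup K) [Fact (κ.IsTopGenerator γ)]
        (𝔭 : HeightOneSpectrum (𝓞 K)), ((3 : ℕ) : 𝓞 K) ∈ 𝔭.asIdeal →
        𝔭.asIdeal.ramificationIdx (𝓞 ℚ) = 1 → 𝔭.asIdeal.inertiaDeg (𝓞 ℚ) = 1 →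
        ∀ (𝔭' : HeightOneSpectrum (𝓞 K)), ((3 : ℕ) : 𝓞 K) ∈ 𝔭'.asIdeal → 𝔭' ≠ 𝔭 →
        ∀ (ι' : PadicAlgCl 3 ≃+* ℂ), BranchInducesPrime 3 ι' 𝔭 →
        ∀ (m : ℕ), 1 ≤ m → ∀ (D : Skinner2016.HidaCongruentMember W' 3 m),
          (2 * (((3 : ℕ) : ℤ) - 1) * ((3 : ℕ) : ℤ) ^ (m - 1)) ∣ D.k - 2 →
          SkinnerUrban2014.IsResiduallyIrreducible D.Δ →
          (∀ a : Cofree D.Δ.selfDualRep (padicCoeffField D.ι),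
              (∀ σ : LocalGroup K (Sum.inl 𝔭'), (D.Δ.selfDualCofreeRepOver K) (localMap K (Sum.inl 𝔭') σ) a = a) →
              (∃ j : ℕ, (3 : ℕ) ^ j • a = 0) → a = 0) →
          (∀ x : coeffField D.g, ι' (D.ι x) = (x : ℂ)) →
        ∀ (b : padicCoeffIntegers D.ι →+* 𝓞_ℂ_[3]),
          (∀ x, ((b x : 𝓞_ℂ_[3]) : ℂ_[3]) = algebraMap (PadicAlgCl 3) ℂ_[3] (padicCoeffIntegers.toPadicAlgCl D.ι x)) →
        ∀ (ΩK : ℂ) (Ωp : (𝓞_ℂ_[3])ˣ) (Q : PowerSeries 𝓞_ℂ_[3]), ΩK ≠ 0 →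
          IsBDPLFunctionWtSigmaInt ι' 𝔭 κ γ D.g (W'.sigmaPlacesFinset 3 K) ΩK ((Ωp : 𝓞_ℂ_[3]) : ℂ_[3]) Q →
        ∀ (κ' : ZpExtension K 3) (γ' : absoluteGaloisGroup K) [Fact (κ'.IsTopGenerator γ')], κ'.IsCyclotomic →
        ∀ [TopologicalSpace (PowerSeries (padicCoeffIntegers D.ι))]
          [TopologicalSpace (PowerSeries (PowerSeries (padicCoeffIntegers D.ι)))]
          [ContinuousSMul (PowerSeries (PowerSeries (padicCoeffIntegers D.ι)))
            (BigRepModule (PowerSeries (padicCoeffIntegers D.ι)) 3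
              (BigRepModule (padicCoeffIntegers D.ι) 3 (Cofree D.Δ.selfDualRep (padicCoeffField D.ι))))],
          Module.IsTorsion (PowerSeries (PowerSeries (padicCoeffIntegers D.ι)))
              (XBig κ' (AnticyclotomicBigGaloisRep κ (D.Δ.selfDualCofreeRepOver K)) 𝔭' (↑(W'.sigmaPlacesFinset 3 K))) →
            ∃ Q₂ : PowerSeries (PowerSeries 𝓞_ℂ_[3]),
              (∃ u : (PowerSeries 𝓞_ℂ_[3])ˣ, PowerSeries.constantCoeff Q₂ = (u : PowerSeries 𝓞_ℂ_[3]) * Q) ∧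
              (XBig.charIdeal κ' (AnticyclotomicBigGaloisRep κ (D.Δ.selfDualCofreeRepOver K)) 𝔭'
                  (↑(W'.sigmaPlacesFinset 3 K))).map (PowerSeries.map (PowerSeries.map b)) ≤ Ideal.span {Q₂}) :
    ∀ (W' : WeierstrassCurve ℚ) [W'.IsElliptic] [W'.IsGloballyMinimal] (N' : ℕ) [NeZero N']
      (K : Type) [Field K] [NumberField K] (Dt' : ModularParametrizationData W' N'),
      Mult W' 3 → W'.HasSurjectiveModNGaloisRep 3 → W'.conductorNorm ℤ = N' → IsImaginaryQuadratic K →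
      SatisfiesHeegnerHypothesis N' K → Odd (NumberField.discr K) → ¬ 3 ∣ padicValInt 3 W'.minimalDiscriminantInt →
      ∀ (κ : ZpExtension K 3), κ.IsAnticyclotomic → ∀ (γ : absoluteGaloisGroup K) [Fact (κ.IsTopGenerator γ)]
        (𝔭 : HeightOneSpectrum (𝓞 K)), ((3 : ℕ) : 𝓞 K) ∈ 𝔭.asIdeal →
        𝔭.asIdeal.ramificationIdx (𝓞 ℚ) = 1 → 𝔭.asIdeal.inertiaDeg (𝓞 ℚ) = 1 →
        ∀ (𝔭' : HeightOneSpectrum (𝓞 K)), ((3 : ℕ) : 𝓞 K) ∈ 𝔭'.asIdeal → 𝔭' ≠ 𝔭 →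
        ∀ (ι' : PadicAlgCl 3 ≃+* ℂ), BranchInducesPrime 3 ι' 𝔭 →
        ∀ (m : ℕ), 1 ≤ m → ∀ (D : Skinner2016.HidaCongruentMember W' 3 m),
          (2 * (((3 : ℕ) : ℤ) - 1) * ((3 : ℕ) : ℤ) ^ (m - 1)) ∣ D.k - 2 →
          SkinnerUrban2014.IsResiduallyIrreducible D.Δ →
          (∀ x : coeffField D.g, ι' (D.ι x) = (x : ℂ)) →
        ∀ (b : padicCoeffIntegers D.ι →+* 𝓞_ℂ_[3]),
          (∀ x, ((b x : 𝓞_ℂ_[3]) : ℂ_[3]) = algebraMap (PadicAlgCl 3) ℂ_[3] (padicCoeffIntegers.toPadicAlgCl D.ι x)) →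
        ∀ (ΩK : ℂ) (Ωp : (𝓞_ℂ_[3])ˣ) (Q : PowerSeries 𝓞_ℂ_[3]), ΩK ≠ 0 →
          IsBDPLFunctionWtSigmaInt ι' 𝔭 κ γ D.g (W'.sigmaPlacesFinset 3 K) ΩK ((Ωp : 𝓞_ℂ_[3]) : ℂ_[3]) Q →
        ∀ [TopologicalSpace (PowerSeries (padicCoeffIntegers D.ι))]
          [ContinuousSMul (PowerSeries (padicCoeffIntegers D.ι))
            (BigRepModule (padicCoeffIntegers D.ι) 3 (Cofree D.Δ.selfDualRep (padicCoeffField D.ι)))],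
          Module.IsTorsion (PowerSeries (padicCoeffIntegers D.ι))
              (XBig κ (D.Δ.selfDualCofreeRepOver K) 𝔭' (↑(W'.sigmaPlacesFinset 3 K))) →
            ∃ e : ℕ, Ideal.span {(PowerSeries.C ((3 : ℕ) : 𝓞_ℂ_[3]) : PowerSeries 𝓞_ℂ_[3]) ^ e} *
                (XBig.charIdeal κ (D.Δ.selfDualCofreeRepOver K) 𝔭' (↑(W'.sigmaPlacesFinset 3 K))).map (PowerSeries.map b) ≤
              Ideal.span {Q} :=
  tresSelfDual_of_decSelfDual (sharpDecDagger_of_twoVarCoreAtThreeDagger hTV)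

/-! ### §3 Item 23310 as filed = (the road's part) ∧ (the peu-ramifié corner) -/

set_option maxHeartbeats 800000 in
-- statement-sized binders over the big representation (as p662412 / p663826); the proof is glue
-- the dormant branch of a restate-robust `first | … | …` is, by design, never executed at the current route rev
set_option linter.unreachableTactic false in
set_option linter.unusedTactic false in
/-- **K1♯†_T ∧ K1♯†_peu ⟹ K1♯†** (item 23310 `TwinSelfDualMemberRationalInclusionAtThree` BY NAME), `by_cases` on `3 ∣ v₃(Δ′_min)`:
what «K1♯† ⟸ TV₃†» lacks after §2 is exactly K1♯†_peu — members over twins multiplicative at `3` with `3 ∣ v₃(Δ′_min)` (this contains the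
¬(dec) corner: split multiplicative with cube Tate parameter), a statement no consumer of the route reads. [folklore] -/
theorem selfDual_of_tresSelfDual_of_peuRamifie
    (hT :
    ∀ (W' : WeierstrassCurve ℚ) [W'.IsElliptic] [W'.IsGloballyMinimal] (N' : ℕ) [NeZero N']
      (K : Type) [Field K] [NumberField K] (Dt' : ModularParametrizationData W' N'),
      Mult W' 3 → W'.HasSurjectiveModNGaloisRep 3 → W'.conductorNorm ℤ = N' → IsImaginaryQuadratic K →
      SatisfiesHeegnerHypothesis N' K → Odd (NumberField.discr K) → ¬ 3 ∣ padicValInt 3 W'.minimalDiscriminantInt →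
      ∀ (κ : ZpExtension K 3), κ.IsAnticyclotomic → ∀ (γ : absoluteGaloisGroup K) [Fact (κ.IsTopGenerator γ)]
        (𝔭 : HeightOneSpectrum (𝓞 K)), ((3 : ℕ) : 𝓞 K) ∈ 𝔭.asIdeal →
        𝔭.asIdeal.ramificationIdx (𝓞 ℚ) = 1 → 𝔭.asIdeal.inertiaDeg (𝓞 ℚ) = 1 →
        ∀ (𝔭' : HeightOneSpectrum (𝓞 K)), ((3 : ℕ) : 𝓞 K) ∈ 𝔭'.asIdeal → 𝔭' ≠ 𝔭 →
        ∀ (ι' : PadicAlgCl 3 ≃+* ℂ), BranchInducesPrime 3 ι' 𝔭 →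
        ∀ (m : ℕ), 1 ≤ m → ∀ (D : Skinner2016.HidaCongruentMember W' 3 m),
          (2 * (((3 : ℕ) : ℤ) - 1) * ((3 : ℕ) : ℤ) ^ (m - 1)) ∣ D.k - 2 →
          SkinnerUrban2014.IsResiduallyIrreducible D.Δ →
          (∀ x : coeffField D.g, ι' (D.ι x) = (x : ℂ)) →
        ∀ (b : padicCoeffIntegers D.ι →+* 𝓞_ℂ_[3]),
          (∀ x, ((b x : 𝓞_ℂ_[3]) : ℂ_[3]) = algebraMap (PadicAlgCl 3) ℂ_[3] (padicCoeffIntegers.toPadicAlgCl D.ι x)) →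
        ∀ (ΩK : ℂ) (Ωp : (𝓞_ℂ_[3])ˣ) (Q : PowerSeries 𝓞_ℂ_[3]), ΩK ≠ 0 →
          IsBDPLFunctionWtSigmaInt ι' 𝔭 κ γ D.g (W'.sigmaPlacesFinset 3 K) ΩK ((Ωp : 𝓞_ℂ_[3]) : ℂ_[3]) Q →
        ∀ [TopologicalSpace (PowerSeries (padicCoeffIntegers D.ι))]
          [ContinuousSMul (PowerSeries (padicCoeffIntegers D.ι))
            (BigRepModule (padicCoeffIntegers D.ι) 3 (Cofree D.Δ.selfDualRep (padicCoeffField D.ι)))],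
          Module.IsTorsion (PowerSeries (padicCoeffIntegers D.ι))
              (XBig κ (D.Δ.selfDualCofreeRepOver K) 𝔭' (↑(W'.sigmaPlacesFinset 3 K))) →
            ∃ e : ℕ, Ideal.span {(PowerSeries.C ((3 : ℕ) : 𝓞_ℂ_[3]) : PowerSeries 𝓞_ℂ_[3]) ^ e} *
                (XBig.charIdeal κ (D.Δ.selfDualCofreeRepOver K) 𝔭' (↑(W'.sigmaPlacesFinset 3 K))).map (PowerSeries.map b) ≤
              Ideal.span {Q})
    (hpeu :
    ∀ (W' : WeierstrassCurve ℚ) [W'.IsElliptic] [W'.IsGloballyMinimal] (N' : ℕ) [NeZero N']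
      (K : Type) [Field K] [NumberField K] (Dt' : ModularParametrizationData W' N'),
      Mult W' 3 → W'.HasSurjectiveModNGaloisRep 3 → W'.conductorNorm ℤ = N' → IsImaginaryQuadratic K →
      SatisfiesHeegnerHypothesis N' K → Odd (NumberField.discr K) → 3 ∣ padicValInt 3 W'.minimalDiscriminantInt →
      ∀ (κ : ZpExtension K 3), κ.IsAnticyclotomic → ∀ (γ : absoluteGaloisGroup K) [Fact (κ.IsTopGenerator γ)]
        (𝔭 : HeightOneSpectrum (𝓞 K)), ((3 : ℕ) : 𝓞 K) ∈ 𝔭.asIdeal →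
        𝔭.asIdeal.ramificationIdx (𝓞 ℚ) = 1 → 𝔭.asIdeal.inertiaDeg (𝓞 ℚ) = 1 →
        ∀ (𝔭' : HeightOneSpectrum (𝓞 K)), ((3 : ℕ) : 𝓞 K) ∈ 𝔭'.asIdeal → 𝔭' ≠ 𝔭 →
        ∀ (ι' : PadicAlgCl 3 ≃+* ℂ), BranchInducesPrime 3 ι' 𝔭 →
        ∀ (m : ℕ), 1 ≤ m → ∀ (D : Skinner2016.HidaCongruentMember W' 3 m),
          (2 * (((3 : ℕ) : ℤ) - 1) * ((3 : ℕ) : ℤ) ^ (m - 1)) ∣ D.k - 2 →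
          SkinnerUrban2014.IsResiduallyIrreducible D.Δ →
          (∀ x : coeffField D.g, ι' (D.ι x) = (x : ℂ)) →
        ∀ (b : padicCoeffIntegers D.ι →+* 𝓞_ℂ_[3]),
          (∀ x, ((b x : 𝓞_ℂ_[3]) : ℂ_[3]) = algebraMap (PadicAlgCl 3) ℂ_[3] (padicCoeffIntegers.toPadicAlgCl D.ι x)) →
        ∀ (ΩK : ℂ) (Ωp : (𝓞_ℂ_[3])ˣ) (Q : PowerSeries 𝓞_ℂ_[3]), ΩK ≠ 0 →
          IsBDPLFunctionWtSigmaInt ι' 𝔭 κ γ D.g (W'.sigmaPlacesFinset 3 K) ΩK ((Ωp : 𝓞_ℂ_[3]) : ℂ_[3]) Q →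
        ∀ [TopologicalSpace (PowerSeries (padicCoeffIntegers D.ι))]
          [ContinuousSMul (PowerSeries (padicCoeffIntegers D.ι))
            (BigRepModule (padicCoeffIntegers D.ι) 3 (Cofree D.Δ.selfDualRep (padicCoeffField D.ι)))],
          Module.IsTorsion (PowerSeries (padicCoeffIntegers D.ι))
              (XBig κ (D.Δ.selfDualCofreeRepOver K) 𝔭' (↑(W'.sigmaPlacesFinset 3 K))) →
            ∃ e : ℕ, Ideal.span {(PowerSeries.C ((3 : ℕ) : 𝓞_ℂ_[3]) : PowerSeries 𝓞_ℂ_[3]) ^ e} *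
                (XBig.charIdeal κ (D.Δ.selfDualCofreeRepOver K) 𝔭' (↑(W'.sigmaPlacesFinset 3 K))).map (PowerSeries.map b) ≤
              Ideal.span {Q}) :
    TwinSelfDualMemberRationalInclusionAtThree := by
  -- RESTATE-ROBUST (pen pss3x g7 sequence T1, 2026-08-29T01:06:02Z): branch 1 proves item 23310 as filed (K1♯†) by cases on
  -- `3 ∣ v₃(Δ′_min)`; branch 2 proves item 23310 restated to K1♯†_T (T2) from `hT` alone (`hpeu` is then idle, kept referenced). Exactly one
  -- branch elaborates at any route rev.
  first
  | intro W' _ _ N' _ K _ _ Dt' hmult hsurj hN' hK hH hodd κ hκ γ _ 𝔭 h𝔭 he hf 𝔭' h𝔭' hne ι' hι'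
    by_cases hdvd : 3 ∣ padicValInt 3 W'.minimalDiscriminantInt
    · exact hpeu W' N' K Dt' hmult hsurj hN' hK hH hodd hdvd κ hκ γ 𝔭 h𝔭 he hf 𝔭' h𝔭' hne ι' hι'
    · exact hT W' N' K Dt' hmult hsurj hN' hK hH hodd hdvd κ hκ γ 𝔭 h𝔭 he hf 𝔭' h𝔭' hne ι' hι'
  | exact (fun _ ↦ hT) hpeu

end Summit.BirchSwinnertonDyer.BirchSwinnertonDyer.Theorems.UniversalToricDescentTwinSelfDualMemberRationalInclusionAtThreeTres

end
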